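import Summits.BirchSwinnertonDyer.BirchSwinnertonDyer.Theorems.PrintCf2SplitBadTwoLocalCyclicOfFrame
import HarnessLib

/-!
# Crux `PrintCf2.SplitBadTwoRankOneOfFacts` (stmt-BirchSwinnertonDyer-20368), road α v10.3, S3c residual (R-BV): `hH1` ((H1′)-all) of -w7 g2's
# `rBV_of_three_factor_values`, VERBATIM, is a theorem

Cell `bsd-print-cf2`, EXTRA WIDTH seat `bsd-line-cf2-p1-w3` g9 (prover-bsd-line-cf2-p1-w3-g9-0); `--supports stmt-BirchSwinnertonDyer-20368`
(helper, Theses-free). HONEST FRAMING: nothing here closes the crux or a registered stub; BSD is not proved by any of this; no summit statement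
is proved by this seat. No definition, no named fact, no `sorry`, no kit. beyond-print theorem: no.

WHAT. **`hH1_holds`**: the hypothesis `hH1` of `RestrictedSelmerPair.rBV_of_three_factor_values` (p665606) — on every frame the
`E[𝔮_r^∞]`-components of the global Kummer classes are locally zero at `v`, «`ι_*⁻¹(res_⊤ range κ) ≤ ker loc_v`» — VERBATIM, as a theorem:
`comap_kummer_le_ker_resOfLe_of_frame_of_cyclic` (p673486: (H1′) ⟸ (T-loc at v) ∧ hfinB′) with (T-loc) := `kummer_local_cyclic_of_classical`
(p674464) ∘ `LocalTrichotomy.classical_local_cyclic` (p677078) and hfinB′ := -w2 g10's `ConjTransport.finite_restrictedSelmerBase_conj_of_finite`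
applied to the frame's `hfin`. With `hSel_holds`/`hcl_holds` (p677409) this completes the discharge of every CM / local-cyclicity input of the
bottom value on BOTH assembly routes (`rBV_of_three_factor_values`: hF2 and hH1; `rBV_of_factor_values_of_sel`: hSel).

References: [Agboola2007] §6 (arXiv p0014:L5); [GreenbergLNM1716] §2 Prop. 2.1; [SilvermanAEC2009] Prop. VII.6.3.
-/

noncomputable section

open scoped Classical

set_option linter.dupNamespace false
set_option autoImplicit false

open NumberField IsDedekindDomain Field WeierstrassCurve
open Literature.NumberTheory.EllipticCurves Literature.NumberTheory.EllipticCurves.GreenbergSelmer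
open Literature.NumberTheory.EllipticCurves.Castella2018.AcSelmer
open Literature.NumberTheory.EllipticCurves.Agboola2007
open Literature.NumberTheory.EllipticCurves.ResKernel
open Literature.NumberTheory.GaloisRepresentations

namespace Summit.BirchSwinnertonDyer.BirchSwinnertonDyer.Theorems.PrintCf2.CMPrimes

open Summit.BirchSwinnertonDyer.BirchSwinnertonDyer.Theorems.PrintCf2.RestrictedSelmerPair
open Summit.BirchSwinnertonDyer.BirchSwinnertonDyer.Theorems.PrintCf2.AdditiveAtSeven
open Summit.BirchSwinnertonDyer.BirchSwinnertonDyer.Theorems.PrintCf2.LocalTrichotomy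

/-- **`hH1` ((H1′)-all) of `rBV_of_three_factor_values`, VERBATIM, is a theorem.** [cite: Agboola2007, §6 (arXiv p0014:L5)]
[cite: GreenbergLNM1716, §2 Prop. 2.1] [cite: SilvermanAEC2009, Prop. VII.6.3] -/
theorem hH1_holds :
    ∀ (d : ℤ), d ≠ 0 → Squarefree d → d % 4 ≠ 1 →
      ∀ (W : WeierstrassCurve ℚ) [W.IsElliptic] [W.IsGloballyMinimal] (C : VariableChange ℚ),
        C • W = cm7.quadraticTwist (d : ℚ) → W.analyticRank = 1 →
      ∀ (K : Type) [Field K] [NumberField K], IsImaginaryQuadratic K →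
      ∀ (v vbar : HeightOneSpectrum (𝓞 K)),
        ((2 : ℕ) : 𝓞 K) ∈ v.asIdeal → ((2 : ℕ) : 𝓞 K) ∈ vbar.asIdeal → vbar ≠ v →
      ∀ (π : (W.baseChange K).endRing), (π : AddMonoid.End (W.baseChange K).geomPoints) * π = π - 2 →
      ∀ (r : ℤ_[2]), r * r = r - 2 →
        (∀ τ ∈ GreenbergSelmer.inertia v, ∀ x : ↥((W.baseChange K).endEigenPrimaryTorsion 2 π r), τ • x = x ∨ τ • x = -x) →
      ∀ (P : W.toAffine.Point) (c₀ : ℕ) (ℓ : ℤ),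
        ¬ IsOfFinAddOrder P →
        (∀ R : W.toAffine.Point, ∃ (k : ℤ) (T : W.toAffine.Point), IsOfFinAddOrder T ∧ R = k • P + T) →
        c₀ ≠ 0 → (W.baseChange ℚ_[2]).IsInReductionKernel (c₀ • W.toPadicPoint 2 P) →
        ‖(W.baseChange ℚ_[2]).padicLogPoint (c₀ • W.toPadicPoint 2 P) / (c₀ : ℚ_[2])‖ = (2 : ℝ) ^ (-ℓ) →
      Finite (restrictedSelmerBase ↥((W.baseChange K).endEigenPrimaryTorsion 2 π r) 2 vbar) →
        ((((W.baseChange K).kummerMapPInfty 2 (W.baseChange K).zsmul_geomPoints_surjective_holds).range).map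
            (resSubgroup ⊤ ((W.baseChange K).geomPrimaryTorsion 2))).comap
          (resH1Hom (ContinuousMonoidHom.id _) ((W.baseChange K).endEigenPrimaryTorsion 2 π r).subtype (fun _ _ ↦ rfl)) ≤
          (resOfLe ↥((W.baseChange K).endEigenPrimaryTorsion 2 π r) (inf_le_left : ⊤ ⊓ decomp v ≤ ⊤)).ker := by
  intro d hd0 _ _ W _ _ C hC _ K _ _ hK v vbar hv hvbar hne π hπ r hr _ P c₀ ℓ hP _ _ _ _ hfin
  haveI : Fact (Nat.Prime 2) := ⟨Nat.prime_two⟩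
  exact comap_kummer_le_ker_resOfLe_of_frame_of_cyclic hd0 W C hC hK v π hπ hr P hP
    (kummer_local_cyclic_of_classical (W.baseChange K) 2 v (classical_local_cyclic hK hv hvbar hne (W.baseChange K)))
    (ConjTransport.finite_restrictedSelmerBase_conj_of_finite W K hK v vbar hv hvbar hne π hπ r hfin)

end Summit.BirchSwinnertonDyer.BirchSwinnertonDyer.Theorems.PrintCf2.CMPrimes

end
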